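import Literature.Analysis.FluidPDE.KNSSSwirlLiouville
import Literature.Analysis.FluidPDE.KNSSRegularityGalilean
import Literature.Analysis.FluidPDE.VorticityStretching
import Literature.Analysis.FluidPDE.AxisymmetricVorticityTransport
import Literature.Analysis.FluidPDE.IsometryInvariance
import Mathlib.Analysis.Calculus.ParametricIntervalIntegral
import HarnessLib

/-!
# KNSS 2009, Theorem 5.3: the swirl equation (5.10) from the vorticity equation (4.5)

Analysis/FluidPDE proofs file on the discharge path of the named fact
`Literature.Analysis.FluidPDE.KNSS2009_regularity_axisymmetric_swirl` (`KNSSSwirlLiouville`; Koch–Nadirashvili–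
Seregin–Šverák, *Liouville theorems for the Navier–Stokes equations and applications*, Acta
Math. 203 (2009) = arXiv:0709.3599, §4 with the first lines of the proof of Theorem 5.3, p. 10:
"We set `f = r u_θ` and recall that `fₜ + u_r f_{,r} + u_z f_{,z} = Δf − (2/r) f_{,r}`",
(5.10) = (5.7) = (1.8)). That fact asks, for the smooth representative `U` of an axisymmetric
bounded ancient weak solution delivered by §4, the swirl equation (5.10) in time-integrated
form, whereas the regularity theory of §4 as vendored in the tree
(`KNSS2009_regularity_boundedWeak_window`, `KNSSRegularityWindow`; glued to `(−∞, 0)` in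
`KNSSRegularityAncient`) records the **vorticity** equation (4.5),
`ω(t) − ω(s) = ∫ₛᵗ (Δω − Dω[u] + DU[ω]) dτ`, `u = U + b(t)`. This file proves that the former
follows from the latter for axisymmetric fields (`swirl_identity_of_vorticity_identity`), which
is the content of the source's remark that (5.10) is the `θ`-component (5.7) of the equations,
"decoupled from the pressure" (p. 9): no momentum equation or pressure is needed.

## The argument

Fix `s ≤ t < 0` and put `G(τ) = ΔU(τ) − DU(τ)[U(τ) + β(τ)e_z]` (the momentum terms without
pressure; the drift of an axisymmetric solution is axial, `b = β e_z`) and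
`A = U(t) − U(s) − ∫ₛᵗ G(τ) dτ : ℝ³ → ℝ³`. Then

* `A` is `C¹`, with `DA = DU(t) − DU(s) − ∫ₛᵗ DG(τ) dτ`: differentiation under the time integral
  (`hasFDerivAt_intervalIntegral_smul`, dominated differentiation with the bound from compactness;
  the joint continuity of `G`, `DG` in `(τ, x)` comes from the time-Lipschitz bounds (4.8) on all
  `∇ᵏU`, `continuousOn_derivatives_of_lipschitz_time`, and `D(ΔU) = Σᵢ D³U(·, eᵢ, eᵢ)` is read
  off `D³U` through a fixed linear map, `hasFDerivAt_laplacian`; the weight `β` is only bounded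
  measurable);
* `curl A = 0`: `curl` is a linear function of the Jacobian, so it passes under the integral, and
  `curl G = Δω − Dω[U + βe_z] + DU[ω]` pointwise (`curl_laplacian`, `curl_convect_self_of_isDivFree`,
  `curl_fderiv_apply`), whence `curl A = ω(t) − ω(s) − ∫ₛᵗ curl G = 0` by (4.5);
* `A` is axisymmetric (rotation covariance of `Δ`, `(U·∇)U` and `∂_z`, `IsometryInvariance`);
* **a curl-free axisymmetric `C¹` field has no swirl** (`swirl_eq_zero_of_curl_eq_zero_of_isAxisymmetric`):
  for `Γ_A = ⟪Jx, A⟫`, `DΓ_A(x)h = ⟪Jx, DA h⟫ + ⟪Jh, A⟫ = ⟪DA(Jx), h⟫ − ⟪h, JA⟫ = 0` by the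
  symmetry of `DA` and the infinitesimal axisymmetry `DA(x)(Jx) = J A(x)`, and `Γ_A = 0` on the axis;
* so `⟪Jx, A(x)⟫ = 0`, i.e. `Γ(t) − Γ(s) = ∫ₛᵗ ⟪Jx, G(τ)⟫ dτ`, and
  `⟪Jx, ΔU − DU[U + βe_z]⟫ = ΔΓ − DΓ[U + βe_z] − (2/r)∂ᵣΓ` off the axis
  (`inner_rotGen_laplacian_sub_fderiv`: `laplacian_swirl`, `fderiv_swirl_apply`, `⟪Jv, v⟫ = 0`,
  `J e_z = 0`, `∂₀U₁ − ∂₁U₀ = (1/r)∂ᵣΓ`), which is (5.10) in time-integrated form.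

Everything here is proved; the assembly of `KNSS2009_regularity_axisymmetric_swirl` from the
finite-window fact is in `KNSSSwirlRegularityOfWindow`.

## Mathlib / tree search

Tree (all reused): `rotGen`, `fderiv_swirl_apply`, `laplacian_swirl`,
`IsAxisymmetric.fderiv_rotGen`, `IsAxisymmetric.partialDeriv_eR_swirl` (`SwirlTransportProofs`);
`rotZL`, `IsAxisymmetric.fderiv_rotZ`, `inner_apply_curlCLM`, `clm_apply_eq_sum`,
`inner_rotGen_left_eq_neg` (`AxisymmetricVorticityTransport`); `curlCLM_apply`,
`curl_convect_self_of_isDivFree` (`VorticityStretching`); `curl_laplacian`, `curl_sub`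
(`VorticityCalculus`); `curl_fderiv_apply`, `fderiv_fderiv_apply_eq` (`TaoEnstrophyLocalisationProofs`);
`laplacian_conj_linearIsometryEquiv`, `convect_conj_linearIsometryEquiv` (`IsometryInvariance`);
`continuousOn_derivatives_of_lipschitz_time` (`KNSSRegularityGalilean`);
`continuousOn_iteratedFDeriv_of_lipschitz` (`KNSSSwirlLiouville`). Mathlib:
`intervalIntegral.hasFDerivAt_integral_of_dominated_of_fderiv_le`, `fderiv_iteratedFDeriv`,
`continuousMultilinearCurryLeftEquiv`, `ContinuousLinearMap.intervalIntegral_comp_comm`,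
`is_const_of_fderiv_eq_zero`, `HasFDerivAt.clm_apply`, `ContinuousLinearMap.flipₗᵢ`.
`lean search 'curl_eq_zero.*swirl|hasFDerivAt_laplacian|intervalIntegral_smul'`: nothing prior.

## References

* G. Koch, N. Nadirashvili, G. Seregin, V. Šverák, *Liouville theorems for the Navier–Stokes
  equations and applications*, Acta Math. 203 (2009) 83–105 = arXiv:0709.3599 (arXiv page
  numbers): §4 (4.5)–(4.8) (p. 8); §5 (5.3)–(5.7), (5.10) (p. 9); proof of Theorem 5.3, first
  lines (p. 10); §1 (1.8). [KochNadirashviliSereginSverak2009]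
* A. J. Majda, A. L. Bertozzi, *Vorticity and Incompressible Flow* (CUP 2002), §1.2 (rotation
  covariance), §2.3.3 (axisymmetric flows, the swirl equation (2.58)–(2.59)).
-/

noncomputable section

open MeasureTheory Set Function Filter Topology TopologicalSpace InnerProductSpace Metric
open scoped RealInnerProductSpace Laplacian ContDiff NNReal Interval

namespace Literature.Analysis.FluidPDE

/-! ### Differentiation under the time integral -/

section UnderIntegral

variable {E F : Type*} [NormedAddCommGroup E] [NormedSpace ℝ E] [FiniteDimensional ℝ E]
  [NormedAddCommGroup F] [NormedSpace ℝ F]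

/-- A bounded measurable scalar weight times a function continuous on `[s, t]` is interval
integrable on `[s, t]`. [folklore] -/
theorem intervalIntegrable_smul_of_continuousOn {β : ℝ → ℝ} {f : ℝ → F} {s t : ℝ} (hst : s ≤ t)
    (hβm : AEStronglyMeasurable β volume) {B : ℝ} (hβB : ∀ τ, |β τ| ≤ B)
    (hf : ContinuousOn f (Icc s t)) : IntervalIntegrable (fun τ => β τ • f τ) volume s t := by
  obtain ⟨M, hM⟩ := isCompact_Icc.exists_bound_of_continuousOn hf
  rw [intervalIntegrable_iff_integrableOn_Icc_of_le hst]
  have hmeas : AEStronglyMeasurable (fun τ => β τ • f τ) ((volume : Measure ℝ).restrict (Icc s t)) :=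
    hβm.restrict.smul (hf.aestronglyMeasurable measurableSet_Icc)
  have hB0 : 0 ≤ B := (abs_nonneg _).trans (hβB s)
  have hbound : ∀ τ ∈ Icc s t, ‖β τ • f τ‖ ≤ B * M := fun τ hτ => by
    rw [norm_smul, Real.norm_eq_abs]
    exact mul_le_mul (hβB τ) (hM τ hτ) (norm_nonneg _) hB0
  exact Integrable.mono' (integrable_const (B * M)) hmeas
    ((ae_restrict_iff' measurableSet_Icc).2 (Eventually.of_forall hbound))

/-- **Differentiation under the time integral, with a bounded measurable weight.** Let
`g : ℝ → E → F` be jointly continuous on `[s, t] × E` with differentiable slices `g τ` and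
`(τ, y) ↦ D(g τ)(y)` jointly continuous on `[s, t] × E`, and let `β` be bounded and measurable.
Then `y ↦ ∫ₛᵗ β τ • g τ y dτ` is differentiable with derivative `∫ₛᵗ β τ • D(g τ)(y) dτ`
(dominated differentiation, the bound coming from compactness of `[s, t] × B̄(y, 1)`), and both
integrands are interval integrable. [folklore] -/
theorem hasFDerivAt_intervalIntegral_smul {g : ℝ → E → F} {β : ℝ → ℝ} {s t : ℝ} (hst : s ≤ t)
    (hβm : AEStronglyMeasurable β volume) {B : ℝ} (hβB : ∀ τ, |β τ| ≤ B)
    (hg : ContinuousOn (uncurry g) (Icc s t ×ˢ univ))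
    (hd : ∀ τ ∈ Icc s t, Differentiable ℝ (g τ))
    (hDg : ContinuousOn (fun p : ℝ × E => fderiv ℝ (g p.1) p.2) (Icc s t ×ˢ univ)) (y : E) :
    IntervalIntegrable (fun τ => β τ • g τ y) volume s t ∧
    IntervalIntegrable (fun τ => β τ • fderiv ℝ (g τ) y) volume s t ∧
    HasFDerivAt (fun z => ∫ τ in s..t, β τ • g τ z) (∫ τ in s..t, β τ • fderiv ℝ (g τ) y) y := by
  have hB0 : 0 ≤ B := (abs_nonneg _).trans (hβB s)
  -- slices in time are continuous on `[s, t]`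
  have hgz : ∀ z, ContinuousOn (fun τ => g τ z) (Icc s t) := fun z =>
    hg.comp (continuousOn_id.prodMk continuousOn_const) fun τ hτ => mk_mem_prod hτ (mem_univ z)
  have hDz : ∀ z, ContinuousOn (fun τ => fderiv ℝ (g τ) z) (Icc s t) := fun z =>
    hDg.comp (continuousOn_id.prodMk continuousOn_const) fun τ hτ => mk_mem_prod hτ (mem_univ z)
  have hI1 : IntervalIntegrable (fun τ => β τ • g τ y) volume s t :=
    intervalIntegrable_smul_of_continuousOn hst hβm hβB (hgz y)
  have hI2 : IntervalIntegrable (fun τ => β τ • fderiv ℝ (g τ) y) volume s t :=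
    intervalIntegrable_smul_of_continuousOn hst hβm hβB (hDz y)
  refine ⟨hI1, hI2, ?_⟩
  -- a uniform bound for the derivative on `[s, t] × B̄(y, 1)`
  have hcpt : IsCompact (Icc s t ×ˢ closedBall y 1) := isCompact_Icc.prod (isCompact_closedBall y 1)
  obtain ⟨M, hM⟩ := hcpt.exists_bound_of_continuousOn
    (hDg.mono (prod_mono Subset.rfl (subset_univ _)))
  -- measurability on `Ι s t ⊆ [s, t]`
  have hΙ : Ι s t ⊆ Icc s t := by
    rw [uIoc_of_le hst]; exact Ioc_subset_Icc_self
  have hres : (volume : Measure ℝ).restrict (Ι s t) ≤ (volume : Measure ℝ).restrict (Icc s t) :=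
    Measure.restrict_mono hΙ le_rfl
  have hmeas : ∀ z, AEStronglyMeasurable (fun τ => β τ • g τ z)
      ((volume : Measure ℝ).restrict (Ι s t)) := fun z =>
    (hβm.restrict.smul ((hgz z).aestronglyMeasurable measurableSet_Icc)).mono_measure hres
  have hmeas' : AEStronglyMeasurable (fun τ => β τ • fderiv ℝ (g τ) y)
      ((volume : Measure ℝ).restrict (Ι s t)) :=
    (hβm.restrict.smul ((hDz y).aestronglyMeasurable measurableSet_Icc)).mono_measure hres
  refine intervalIntegral.hasFDerivAt_integral_of_dominated_of_fderiv_le (μ := volume)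
    (F := fun z τ => β τ • g τ z) (F' := fun z τ => β τ • fderiv ℝ (g τ) z) (x₀ := y)
    (bound := fun _ => B * M) (ball_mem_nhds y one_pos) (Eventually.of_forall hmeas) hI1 hmeas'
    ?_ intervalIntegrable_const ?_
  · refine Eventually.of_forall fun τ hτ z hz => ?_
    rw [norm_smul, Real.norm_eq_abs]
    exact mul_le_mul (hβB τ) (hM (τ, z) (mk_mem_prod (hΙ hτ) (ball_subset_closedBall hz)))
      (norm_nonneg _) hB0
  · exact Eventually.of_forall fun τ hτ z _ => ((hd τ (hΙ hτ) z).hasFDerivAt).const_smul (β τ)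

end UnderIntegral

/-! ### The Laplacian as a linear function of the second derivative; its derivative -/

section LaplacianCLM

variable {E F : Type*} [NormedAddCommGroup E] [InnerProductSpace ℝ E] [FiniteDimensional ℝ E]
  [NormedAddCommGroup F] [NormedSpace ℝ F]

/-- The Laplacian is a fixed continuous linear function of the second derivative:
`Δ f (x) = ℓ (D²f(x))` with `ℓ m = Σᵢ m(bᵢ, bᵢ)` over the standard orthonormal basis (the sum of
the evaluation functionals `ContinuousMultilinearMap.apply`). [folklore] -/
theorem laplacian_eq_sum_apply_iteratedFDeriv (f : E → F) (x : E) :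
    (Δ f) x = (∑ i, ContinuousMultilinearMap.apply ℝ (fun _ : Fin 2 => E) F
      ![stdOrthonormalBasis ℝ E i, stdOrthonormalBasis ℝ E i]) (iteratedFDeriv ℝ 2 f x) := by
  rw [laplacian_eq_iteratedFDeriv_stdOrthonormalBasis]
  simp

/-- **Derivative of the Laplacian of a `C³` map**: `D(Δ f)(x) = ℓ ∘ curry(D³f(x))`, a continuous
(linear) function of the third derivative, where `ℓ m = Σᵢ m(bᵢ, bᵢ)`
(`laplacian_eq_sum_apply_iteratedFDeriv`, `fderiv_iteratedFDeriv`). [folklore] -/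
theorem hasFDerivAt_laplacian {f : E → F} (hf : ContDiff ℝ 3 f) (x : E) :
    HasFDerivAt (Δ f) ((∑ i, ContinuousMultilinearMap.apply ℝ (fun _ : Fin 2 => E) F
        ![stdOrthonormalBasis ℝ E i, stdOrthonormalBasis ℝ E i]).comp
      ((continuousMultilinearCurryLeftEquiv ℝ (fun _ : Fin 3 => E) F) (iteratedFDeriv ℝ 3 f x)))
      x := by
  set ℓ : (E [×2]→L[ℝ] F) →L[ℝ] F := ∑ i, ContinuousMultilinearMap.apply ℝ (fun _ : Fin 2 => E) F
    ![stdOrthonormalBasis ℝ E i, stdOrthonormalBasis ℝ E i] with hℓ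
  have hfun : Δ f = fun y => ℓ (iteratedFDeriv ℝ 2 f y) :=
    funext fun y => laplacian_eq_sum_apply_iteratedFDeriv f y
  have hd : DifferentiableAt ℝ (iteratedFDeriv ℝ 2 f) x :=
    (hf.differentiable_iteratedFDeriv (m := 2) (by norm_cast)) x
  have h2 : HasFDerivAt (iteratedFDeriv ℝ 2 f)
      ((continuousMultilinearCurryLeftEquiv ℝ (fun _ : Fin 3 => E) F) (iteratedFDeriv ℝ 3 f x))
      x := by
    have h := hd.hasFDerivAt
    rwa [fderiv_iteratedFDeriv] at h
  rw [hfun]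
  exact ℓ.hasFDerivAt.comp x h2

end LaplacianCLM

section R3

/-- Local notation for physical space `ℝ³ = EuclideanSpace ℝ (Fin 3)`. -/
local notation "ℝ³" => EuclideanSpace ℝ (Fin 3)

/-! ### Curl-free axisymmetric fields have no swirl -/

/-- A linear map of `ℝ³` with vanishing axial vector (`curlCLM L = 0`, i.e. a symmetric matrix)
is self-adjoint: `⟪L v, w⟫ = ⟪v, L w⟫`. [folklore] -/
theorem inner_apply_comm_of_curlCLM_eq_zero (L : ℝ³ →L[ℝ] ℝ³) (hL : curlCLM L = 0)
    (v w : ℝ³) : ⟪L v, w⟫ = ⟪v, L w⟫ := by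
  have h0 := congrArg (fun z : ℝ³ => z 0) hL
  have h1 := congrArg (fun z : ℝ³ => z 1) hL
  have h2 := congrArg (fun z : ℝ³ => z 2) hL
  simp only [curlCLM_apply, PiLp.zero_apply, PiLp.toLp_apply, Matrix.cons_val_zero,
    Matrix.cons_val_one, Matrix.cons_val_two, Matrix.head_cons, Matrix.tail_cons] at h0 h1 h2
  rw [clm_apply_eq_sum L v, clm_apply_eq_sum L w]
  simp only [PiLp.inner_apply, RCLike.inner_apply, conj_trivial, Fin.sum_univ_three,
    PiLp.add_apply, PiLp.smul_apply, smul_eq_mul]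
  linear_combination (v 1 * w 2 - v 2 * w 1) * h0 + (v 2 * w 0 - v 0 * w 2) * h1 +
    (v 0 * w 1 - v 1 * w 0) * h2

/-- **A curl-free axisymmetric field has no swirl.** If `A : ℝ³ → ℝ³` is differentiable,
`curl A = 0` and `A (R_θ y) = R_θ (A y)` for all rotations about the axis, then
`Γ_A = ⟪J y, A y⟫ = y₀A₁ − y₁A₀` vanishes identically: its gradient is
`DΓ_A(y)h = ⟪Jy, DA(y)h⟫ + ⟪Jh, A(y)⟫ = ⟪DA(y)(Jy), h⟫ − ⟪h, J A(y)⟫ = 0` by the symmetry of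
`DA(y)` and the infinitesimal axisymmetry `DA(y)(Jy) = J A(y)`, and `Γ_A = 0` on the axis.
(Equivalently: `A = ∇q` with `q` axisymmetric, so `A_θ = ∂_θ q / r = 0`.) [folklore] -/
theorem swirl_eq_zero_of_curl_eq_zero_of_isAxisymmetric {A : ℝ³ → ℝ³} (hd : Differentiable ℝ A)
    (hcurl : ∀ y, curl A y = 0) (hax : IsAxisymmetric A) (y : ℝ³) : swirl A y = 0 := by
  have hD : ∀ z, fderiv ℝ (swirl A) z = 0 := by
    intro z
    ext h
    rw [fderiv_swirl_apply (hd z) h, _root_.zero_apply]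
    have hsymm := inner_apply_comm_of_curlCLM_eq_zero (fderiv ℝ A z)
      (by rw [← curl_eq_curlCLM]; exact hcurl z) (rotGen z) h
    rw [← hsymm, hax.fderiv_rotGen (hd z), inner_rotGen_left_eq_neg h (A z),
      real_inner_comm (rotGen (A z)) h, add_neg_cancel]
  have hdiff : Differentiable ℝ (swirl A) := fun z => differentiableAt_swirl (hd z)
  rw [is_const_of_fderiv_eq_zero hdiff hD y 0]
  simp [swirl]

/-! ### Rotations: axisymmetry of `Δ V`, `(V·∇)V`, `∂_z V` -/

/-- The generator kills the axial unit vector: `J e_z = 0`. [folklore] -/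
@[simp] theorem rotGen_eZ : rotGen eZ = 0 := rotGen_single_two

/-- Conjugating an axisymmetric field by the isometry `R_θ` gives it back (function form of
`IsAxisymmetric.rotZ_apply_rotZ_neg`). [folklore] -/
theorem IsAxisymmetric.conj_rotZLIE_eq {V : ℝ³ → ℝ³} (hV : IsAxisymmetric V) (θ : ℝ) :
    (fun z => rotZLIE θ (V ((rotZLIE θ).symm z))) = V :=
  funext fun z => by simp [hV.rotZ_apply_rotZ_neg θ z]

/-- **The Laplacian of an axisymmetric field is axisymmetric**: `ΔV (R_θ y) = R_θ (ΔV y)`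
(rotation covariance of `Δ`, `laplacian_conj_linearIsometryEquiv`). [folklore] -/
theorem IsAxisymmetric.laplacian_rotZ {V : ℝ³ → ℝ³} (hV : IsAxisymmetric V) (θ : ℝ) (y : ℝ³) :
    (Δ V) (rotZ θ y) = rotZ θ ((Δ V) y) := by
  have h := laplacian_conj_linearIsometryEquiv (rotZLIE θ) V (rotZLIE θ y)
  rw [hV.conj_rotZLIE_eq θ, LinearIsometryEquiv.symm_apply_apply] at h
  simpa using h

/-- **The convective term of an axisymmetric field is axisymmetric**:
`(V·∇)V (R_θ y) = R_θ ((V·∇)V y)` (`convect_conj_linearIsometryEquiv`). [folklore] -/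
theorem IsAxisymmetric.convect_rotZ {V : ℝ³ → ℝ³} (hV : IsAxisymmetric V) (θ : ℝ) (y : ℝ³) :
    convect V V (rotZ θ y) = rotZ θ (convect V V y) := by
  have h := convect_conj_linearIsometryEquiv (rotZLIE θ) V V (rotZLIE θ y)
  rw [hV.conj_rotZLIE_eq θ, LinearIsometryEquiv.symm_apply_apply] at h
  simpa using h

/-- **The axial derivative of an axisymmetric field is axisymmetric**:
`DV(R_θ y) e_z = R_θ (DV(y) e_z)` (`DV(R_θ y) = R_θ DV(y) R_{−θ}` and `R_{−θ} e_z = e_z`). [folklore] -/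
theorem IsAxisymmetric.fderiv_eZ_rotZ {V : ℝ³ → ℝ³} (hV : IsAxisymmetric V)
    (hd : Differentiable ℝ V) (θ : ℝ) (y : ℝ³) :
    fderiv ℝ V (rotZ θ y) eZ = rotZ θ (fderiv ℝ V y eZ) := by
  have hz : rotZ (-θ) eZ = eZ := by
    ext i
    fin_cases i <;> simp [rotZ, eZ]
  rw [hV.fderiv_rotZ hd θ y]
  simp [hz]

/-! ### Pairing the momentum terms with the generator -/

/-- `⟪J x, ΔV − DV(V + β e_z)⟫ = ΔΓ − DΓ[V + β e_z] − (2/r) ∂ᵣΓ` off the axis, for an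
axisymmetric `C²` field `V` with swirl `Γ = swirl V` (`laplacian_swirl`, `fderiv_swirl_apply`,
`⟪J v, v⟫ = 0`, `J e_z = 0`, and `∂₀V₁ − ∂₁V₀ = (1/r) ∂ᵣΓ`, `IsAxisymmetric.partialDeriv_eR_swirl`):
the computation "pair the `θ`-momentum equation with `r`" behind KNSS's (1.8)/(5.10). [cite: KochNadirashviliSereginSverak2009, §1 (1.8) and §5 (5.7), (5.10) (arXiv pp. 9–10)] -/
theorem inner_rotGen_laplacian_sub_fderiv {V : ℝ³ → ℝ³} (hV2 : ContDiff ℝ 2 V)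
    (hax : IsAxisymmetric V) (β : ℝ) {x : ℝ³} (hx : cylRadius x ≠ 0) :
    ⟪rotGen x, (Δ V) x - fderiv ℝ V x (V x + β • eZ)⟫ =
      (Δ (swirl V)) x - fderiv ℝ (swirl V) x (V x + β • eZ) -
        2 / cylRadius x * partialDeriv (eR x) (swirl V) x := by
  have hd : DifferentiableAt ℝ V x := (hV2.differentiable (by norm_num)) x
  rw [inner_sub_right, laplacian_swirl hV2 x, fderiv_swirl_apply hd, hax.partialDeriv_eR_swirl hd,
    rotGen_add, rotGen_smul, rotGen_eZ, smul_zero, add_zero, inner_rotGen_self]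
  field_simp
  ring

/-! ### Interval integrability is preserved by continuous linear maps -/

/-- A continuous linear map preserves interval integrability. [folklore] -/
theorem IntervalIntegrable.clm_comp {F G : Type*} [NormedAddCommGroup F] [NormedSpace ℝ F]
    [NormedAddCommGroup G] [NormedSpace ℝ G] (L : F →L[ℝ] G) {f : ℝ → F} {a b : ℝ}
    (hf : IntervalIntegrable f volume a b) : IntervalIntegrable (fun τ => L (f τ)) volume a b :=
  ⟨L.integrable_comp hf.1, L.integrable_comp hf.2⟩

/-! ### The swirl equation from the vorticity equation -/

/-- **KNSS 2009, (5.10) from (4.5): the time-integrated swirl equation of an axisymmetric smooth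
representative follows from its time-integrated vorticity equation.** Let `V : ℝ → ℝ³ → ℝ³` have
`C^∞`, divergence-free, axisymmetric slices `V(τ, ·)` for `τ < 0`, with all iterated spatial
derivatives Lipschitz in time uniformly in `x` (KNSS (4.8)), let `β` be bounded measurable, and
suppose the vorticity `ω = curl V` satisfies the vorticity equation (4.5) with drift
`u = V + β e_z` in time-integrated form,
`ω(t, x) − ω(s, x) = ∫ₛᵗ (Δω − Dω[V + β e_z] + DV[ω])(τ, x) dτ` (`x ∈ ℝ³`, `s ≤ t < 0`). Then the
swirl `Γ = swirl V = x₀V₁ − x₁V₀ = r u_θ` satisfies the swirl equation (5.10) = (1.8) with the same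
drift, off the axis, in time-integrated form:
`Γ(t, x) − Γ(s, x) = ∫ₛᵗ (ΔΓ − DΓ[V + β e_z] − (2/r) ∂ᵣΓ)(τ, x) dτ` (`r(x) ≠ 0`, `s ≤ t < 0`).
Proof: the field `A = V(t) − V(s) − ∫ₛᵗ (ΔV − DV[V + β e_z]) dτ` is `C¹` (differentiation under
the integral, `hasFDerivAt_intervalIntegral_smul`), axisymmetric (rotation covariance of `Δ`,
`(V·∇)V`, `∂_z`), and curl free, because `curl` passes under the integral and
`curl (ΔV − DV[V] − β ∂_zV) = Δω − Dω[V] + DV[ω] − β ∂_zω` (`curl_laplacian`,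
`curl_convect_self_of_isDivFree`, `curl_fderiv_apply`) is the vorticity integrand; hence
`⟪Jx, A(x)⟫ = 0` (`swirl_eq_zero_of_curl_eq_zero_of_isAxisymmetric`), which is the claim after
pairing the integrand with `J x` (`inner_rotGen_laplacian_sub_fderiv`). In the source this is the
remark that (5.10) is the `θ`-component (5.7) of the Navier–Stokes equations for the regular
representative of §4, the pressure of an axisymmetric flow being axisymmetric. [cite: KochNadirashviliSereginSverak2009, §5 (5.7), (5.10) and proof of Thm 5.3, first lines (arXiv pp. 9–10); §4 (4.5)] -/
theorem swirl_identity_of_vorticity_identity {V : ℝ → ℝ³ → ℝ³} {β : ℝ → ℝ}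
    (hsm : ∀ t < 0, ContDiff ℝ ∞ (V t)) (hdiv : ∀ t < 0, VectorCalculus.IsDivFree (V t))
    (hax : ∀ t < 0, IsAxisymmetric (V t))
    (hlip : ∀ k : ℕ, ∃ L : ℝ, ∀ s < 0, ∀ t < 0, ∀ x,
      ‖iteratedFDeriv ℝ k (V t) x - iteratedFDeriv ℝ k (V s) x‖ ≤ L * |t - s|)
    (hβm : Measurable β) (hβb : ∃ B : ℝ, ∀ t, |β t| ≤ B)
    (hvort : ∀ x, ∀ s t : ℝ, s ≤ t → t < 0 →
      curl (V t) x - curl (V s) x =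
        ∫ τ in s..t, ((Δ (curl (V τ))) x - fderiv ℝ (curl (V τ)) x (V τ x + β τ • eZ) +
          fderiv ℝ (V τ) x (curl (V τ) x))) :
    ∀ x, cylRadius x ≠ 0 → ∀ s t : ℝ, s ≤ t → t < 0 →
      swirl (V t) x - swirl (V s) x =
        ∫ τ in s..t, ((Δ (swirl (V τ))) x - fderiv ℝ (swirl (V τ)) x (V τ x + β τ • eZ) -
          2 / cylRadius x * partialDeriv (eR x) (swirl (V τ)) x) := by
  intro x₀ hx₀ s t hst ht
  have hs : s < 0 := lt_of_le_of_lt hst ht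
  obtain ⟨B, hB⟩ := hβb
  choose L hL using hlip
  have hβm' : AEStronglyMeasurable β volume := hβm.aestronglyMeasurable
  set S : Set (ℝ × ℝ³) := Iio 0 ×ˢ univ with hS
  have hIcc : Icc s t ⊆ Iio 0 := fun τ hτ => lt_of_le_of_lt hτ.2 ht
  have hIccS : Icc s t ×ˢ (univ : Set ℝ³) ⊆ S := prod_mono hIcc Subset.rfl
  have huIcc : ∀ τ ∈ uIcc s t, τ < 0 := fun τ hτ => by
    rw [uIcc_of_le hst] at hτ; exact hIcc hτ
  -- smoothness in the degrees used
  have hV3 : ∀ τ < 0, ContDiff ℝ 3 (V τ) := fun τ hτ => (hsm τ hτ).of_le (by norm_cast)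
  have hV2 : ∀ τ < 0, ContDiff ℝ 2 (V τ) := fun τ hτ => (hsm τ hτ).of_le (by norm_cast)
  have hV1 : ∀ τ < 0, ContDiff ℝ 1 (V τ) := fun τ hτ => (hsm τ hτ).of_le (by norm_cast)
  have hVd : ∀ τ < 0, Differentiable ℝ (V τ) := fun τ hτ =>
    (hV1 τ hτ).differentiable one_ne_zero
  have hDVd : ∀ τ < 0, Differentiable ℝ (fderiv ℝ (V τ)) := fun τ hτ =>
    ((hV2 τ hτ).fderiv_right (m := 1) le_rfl).differentiable one_ne_zero
  -- joint continuity of `V`, `DV`, `D²V` and of the iterated derivatives on `(−∞, 0) × ℝ³`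
  have h4 : ∀ k : ℕ, ∀ τ ∈ Iio (0 : ℝ), ∀ τ' ∈ Iio (0 : ℝ), ∀ x,
      ‖iteratedFDeriv ℝ k (V τ) x - iteratedFDeriv ℝ k (V τ') x‖ ≤ L k * |τ - τ'| :=
    fun k τ hτ τ' hτ' x => hL k τ' hτ' τ hτ x
  obtain ⟨c0, c1, c2, -⟩ := continuousOn_derivatives_of_lipschitz_time (S := Iio 0) hsm h4
  have cI : ∀ k, ContinuousOn (fun p : ℝ × ℝ³ => iteratedFDeriv ℝ k (V p.1) p.2) S := fun k =>
    continuousOn_iteratedFDeriv_of_lipschitz hsm (hL k)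
  -- the two integrands `G₁ = ΔV − (V·∇)V`, `G₂ = ∂_z V`, and their derivatives
  set G₁ : ℝ → ℝ³ → ℝ³ := fun τ y => (Δ (V τ)) y - fderiv ℝ (V τ) y (V τ y) with hG₁
  set G₂ : ℝ → ℝ³ → ℝ³ := fun τ y => fderiv ℝ (V τ) y eZ with hG₂
  set lap : (ℝ³ [×2]→L[ℝ] ℝ³) →L[ℝ] ℝ³ := ∑ i, ContinuousMultilinearMap.apply ℝ
    (fun _ : Fin 2 => ℝ³) ℝ³ ![stdOrthonormalBasis ℝ ℝ³ i, stdOrthonormalBasis ℝ ℝ³ i] with hlap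
  set cur := continuousMultilinearCurryLeftEquiv ℝ (fun _ : Fin 3 => ℝ³) ℝ³ with hcur
  set D₁ : ℝ → ℝ³ → (ℝ³ →L[ℝ] ℝ³) := fun τ y =>
    lap.comp (cur (iteratedFDeriv ℝ 3 (V τ) y)) -
      ((fderiv ℝ (V τ) y).comp (fderiv ℝ (V τ) y) + (fderiv ℝ (fderiv ℝ (V τ)) y).flip (V τ y))
    with hD₁
  set D₂ : ℝ → ℝ³ → (ℝ³ →L[ℝ] ℝ³) := fun τ y => fderiv ℝ (fderiv ℝ (V τ)) y eZ with hD₂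
  have hG₁d : ∀ τ < 0, ∀ y, HasFDerivAt (G₁ τ) (D₁ τ y) y := fun τ hτ y =>
    (hasFDerivAt_laplacian (hV3 τ hτ) y).sub
      ((hDVd τ hτ y).hasFDerivAt.clm_apply (hVd τ hτ y).hasFDerivAt)
  have hG₂d : ∀ τ < 0, ∀ y, HasFDerivAt (G₂ τ) (D₂ τ y) y := by
    intro τ hτ y
    have hdiff : DifferentiableAt ℝ (G₂ τ) y := (hDVd τ hτ y).clm_apply (differentiableAt_const eZ)
    have h := hdiff.hasFDerivAt
    simp only [hG₂] at h ⊢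
    rwa [fderiv_fderiv_apply_eq (hV2 τ hτ) y eZ] at h
  have hG₁c : ContinuousOn (uncurry G₁) S := by
    have hΔ : ContinuousOn (fun p : ℝ × ℝ³ => (Δ (V p.1)) p.2) S :=
      (lap.continuous.comp_continuousOn (cI 2)).congr fun p _ =>
        laplacian_eq_sum_apply_iteratedFDeriv (V p.1) p.2
    exact hΔ.sub (c1.clm_apply c0)
  have hD₁c : ContinuousOn (fun p : ℝ × ℝ³ => D₁ p.1 p.2) S := by
    have hA : ContinuousOn (fun p : ℝ × ℝ³ => lap.comp (cur (iteratedFDeriv ℝ 3 (V p.1) p.2))) S :=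
      continuousOn_const.clm_comp (cur.continuous.comp_continuousOn (cI 3))
    have hflip : ContinuousOn
        (fun p : ℝ × ℝ³ => (fderiv ℝ (fderiv ℝ (V p.1)) p.2).flip (V p.1 p.2)) S :=
      ((ContinuousLinearMap.flipₗᵢ ℝ ℝ³ ℝ³ ℝ³).continuous.comp_continuousOn c2).clm_apply c0
    exact hA.sub ((c1.clm_comp c1).add hflip)
  have hD₁c' : ContinuousOn (fun p : ℝ × ℝ³ => fderiv ℝ (G₁ p.1) p.2) S :=
    hD₁c.congr fun p hp => (hG₁d p.1 (mem_prod.1 hp).1 p.2).fderiv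
  have hG₂c : ContinuousOn (uncurry G₂) S := c1.clm_apply continuousOn_const
  have hD₂c' : ContinuousOn (fun p : ℝ × ℝ³ => fderiv ℝ (G₂ p.1) p.2) S :=
    (c2.clm_apply continuousOn_const).congr fun p hp => (hG₂d p.1 (mem_prod.1 hp).1 p.2).fderiv
  -- differentiation under the time integral
  have K₁ : ∀ y, IntervalIntegrable (fun τ => G₁ τ y) volume s t ∧
      IntervalIntegrable (fun τ => fderiv ℝ (G₁ τ) y) volume s t ∧
      HasFDerivAt (fun z => ∫ τ in s..t, G₁ τ z) (∫ τ in s..t, fderiv ℝ (G₁ τ) y) y := by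
    intro y
    have h := hasFDerivAt_intervalIntegral_smul (g := G₁) (β := fun _ => (1 : ℝ)) hst
      aestronglyMeasurable_const (B := 1) (fun _ => by norm_num) (hG₁c.mono hIccS)
      (fun τ hτ z => (hG₁d τ (hIcc hτ) z).differentiableAt) (hD₁c'.mono hIccS) y
    simpa only [one_smul] using h
  have K₂ : ∀ y, IntervalIntegrable (fun τ => β τ • G₂ τ y) volume s t ∧
      IntervalIntegrable (fun τ => β τ • fderiv ℝ (G₂ τ) y) volume s t ∧
      HasFDerivAt (fun z => ∫ τ in s..t, β τ • G₂ τ z) (∫ τ in s..t, β τ • fderiv ℝ (G₂ τ) y) y :=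
    fun y => hasFDerivAt_intervalIntegral_smul (g := G₂) hst hβm' hB (hG₂c.mono hIccS)
      (fun τ hτ z => (hG₂d τ (hIcc hτ) z).differentiableAt) (hD₂c'.mono hIccS) y
  -- the field `A = V(t) − V(s) − ∫ G₁ + ∫ β G₂`
  set A : ℝ³ → ℝ³ := fun y =>
    V t y - V s y - (∫ τ in s..t, G₁ τ y) + ∫ τ in s..t, β τ • G₂ τ y with hA
  have hAd' : ∀ y, HasFDerivAt A (fderiv ℝ (V t) y - fderiv ℝ (V s) y -
      (∫ τ in s..t, fderiv ℝ (G₁ τ) y) + ∫ τ in s..t, β τ • fderiv ℝ (G₂ τ) y) y := fun y =>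
    (((hVd t ht y).hasFDerivAt.sub (hVd s hs y).hasFDerivAt).sub (K₁ y).2.2).add (K₂ y).2.2
  have hAd : Differentiable ℝ A := fun y => (hAd' y).differentiableAt
  -- `A` is curl free: `curl` passes under the integral and meets the vorticity identity
  have hcurlA : ∀ y, curl A y = 0 := by
    intro y
    have hint : ∫ τ in s..t, (curlCLM (fderiv ℝ (G₁ τ) y) - curlCLM (β τ • fderiv ℝ (G₂ τ) y)) =
        ∫ τ in s..t, ((Δ (curl (V τ))) y - fderiv ℝ (curl (V τ)) y (V τ y + β τ • eZ) +
          fderiv ℝ (V τ) y (curl (V τ) y)) := by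
      refine intervalIntegral.integral_congr fun τ hτ => ?_
      have hτ0 : τ < 0 := huIcc τ hτ
      have e1 : curlCLM (fderiv ℝ (G₁ τ) y) =
          (Δ (curl (V τ))) y - (convect (V τ) (curl (V τ)) y - convect (curl (V τ)) (V τ) y) := by
        rw [← curl_eq_curlCLM]
        have hcd : DifferentiableAt ℝ (convect (V τ) (V τ)) y :=
          (hDVd τ hτ0 y).clm_apply (hVd τ hτ0 y)
        show curl (fun z => (Δ (V τ)) z - convect (V τ) (V τ) z) y = _
        rw [curl_sub (hasFDerivAt_laplacian (hV3 τ hτ0) y).differentiableAt hcd,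
          curl_laplacian (hV3 τ hτ0) y, curl_convect_self_of_isDivFree (hV2 τ hτ0) (hdiv τ hτ0) y]
      have e2 : curlCLM (β τ • fderiv ℝ (G₂ τ) y) = β τ • fderiv ℝ (curl (V τ)) y eZ := by
        rw [map_smul, ← curl_eq_curlCLM]
        simp only [hG₂]
        rw [curl_fderiv_apply (hV2 τ hτ0) y eZ]
      simp only [e1, e2, convect_apply, map_add, map_smul]
      abel
    have hcomm₁ : curlCLM (∫ τ in s..t, fderiv ℝ (G₁ τ) y) =
        ∫ τ in s..t, curlCLM (fderiv ℝ (G₁ τ) y) :=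
      (curlCLM.intervalIntegral_comp_comm (K₁ y).2.1).symm
    have hcomm₂ : curlCLM (∫ τ in s..t, β τ • fderiv ℝ (G₂ τ) y) =
        ∫ τ in s..t, curlCLM (β τ • fderiv ℝ (G₂ τ) y) :=
      (curlCLM.intervalIntegral_comp_comm (K₂ y).2.1).symm
    rw [curl_eq_curlCLM, (hAd' y).fderiv, map_add, map_sub, map_sub, ← curl_eq_curlCLM,
      ← curl_eq_curlCLM, hvort y s t hst ht, hcomm₁, hcomm₂, ← hint,
      intervalIntegral.integral_sub (IntervalIntegrable.clm_comp curlCLM (K₁ y).2.1)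
        (IntervalIntegrable.clm_comp curlCLM (K₂ y).2.1)]
    abel
  -- `A` is axisymmetric
  have hAax : IsAxisymmetric A := by
    intro θ y
    have e1 : ∫ τ in s..t, G₁ τ (rotZ θ y) = rotZL θ (∫ τ in s..t, G₁ τ y) := by
      rw [← (rotZL θ).intervalIntegral_comp_comm (K₁ y).1]
      refine intervalIntegral.integral_congr fun τ hτ => ?_
      have hτ0 : τ < 0 := huIcc τ hτ
      show (Δ (V τ)) (rotZ θ y) - convect (V τ) (V τ) (rotZ θ y) =
        rotZL θ ((Δ (V τ)) y - convect (V τ) (V τ) y)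
      rw [(hax τ hτ0).laplacian_rotZ, (hax τ hτ0).convect_rotZ, map_sub, rotZL_apply, rotZL_apply]
    have e2 : ∫ τ in s..t, β τ • G₂ τ (rotZ θ y) = rotZL θ (∫ τ in s..t, β τ • G₂ τ y) := by
      rw [← (rotZL θ).intervalIntegral_comp_comm (K₂ y).1]
      refine intervalIntegral.integral_congr fun τ hτ => ?_
      have hτ0 : τ < 0 := huIcc τ hτ
      show β τ • fderiv ℝ (V τ) (rotZ θ y) eZ = rotZL θ (β τ • fderiv ℝ (V τ) y eZ)
      rw [(hax τ hτ0).fderiv_eZ_rotZ (hVd τ hτ0), map_smul, rotZL_apply]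
    simp only [hA]
    rw [e1, e2, hax t ht θ y, hax s hs θ y, ← rotZL_apply, ← rotZL_apply, ← rotZL_apply, map_add,
      map_sub, map_sub]
  -- hence `A` has no swirl; read off the identity at `x₀`
  have key := swirl_eq_zero_of_curl_eq_zero_of_isAxisymmetric hAd hcurlA hAax x₀
  rw [swirl_eq_inner_rotGen] at key
  simp only [hA, inner_add_right, inner_sub_right] at key
  have i1 : ⟪rotGen x₀, ∫ τ in s..t, G₁ τ x₀⟫ = ∫ τ in s..t, ⟪rotGen x₀, G₁ τ x₀⟫ := by
    rw [← innerSL_apply_apply (𝕜 := ℝ), ← (innerSL ℝ (rotGen x₀)).intervalIntegral_comp_comm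
      (K₁ x₀).1]
    rfl
  have i2 : ⟪rotGen x₀, ∫ τ in s..t, β τ • G₂ τ x₀⟫ = ∫ τ in s..t, ⟪rotGen x₀, β τ • G₂ τ x₀⟫ := by
    rw [← innerSL_apply_apply (𝕜 := ℝ), ← (innerSL ℝ (rotGen x₀)).intervalIntegral_comp_comm
      (K₂ x₀).1]
    rfl
  have hΓ : ∀ τ, swirl (V τ) x₀ = ⟪rotGen x₀, V τ x₀⟫ := fun τ =>
    congrFun (swirl_eq_inner_rotGen (V τ)) x₀
  rw [hΓ t, hΓ s]
  have hfinal : ∫ τ in s..t, ((Δ (swirl (V τ))) x₀ - fderiv ℝ (swirl (V τ)) x₀ (V τ x₀ + β τ • eZ) -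
      2 / cylRadius x₀ * partialDeriv (eR x₀) (swirl (V τ)) x₀) =
      ∫ τ in s..t, (⟪rotGen x₀, G₁ τ x₀⟫ - ⟪rotGen x₀, β τ • G₂ τ x₀⟫) := by
    refine intervalIntegral.integral_congr fun τ hτ => ?_
    have hτ0 : τ < 0 := huIcc τ hτ
    simp only [hG₁, hG₂]
    rw [← inner_sub_right, ← inner_rotGen_laplacian_sub_fderiv (hV2 τ hτ0) (hax τ hτ0) (β τ) hx₀,
      map_add, map_smul]
    congr 1
    abel
  have j1 : IntervalIntegrable (fun τ => ⟪rotGen x₀, G₁ τ x₀⟫) volume s t :=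
    IntervalIntegrable.clm_comp (innerSL ℝ (rotGen x₀)) (K₁ x₀).1
  have j2 : IntervalIntegrable (fun τ => ⟪rotGen x₀, β τ • G₂ τ x₀⟫) volume s t :=
    IntervalIntegrable.clm_comp (innerSL ℝ (rotGen x₀)) (K₂ x₀).1
  rw [hfinal, intervalIntegral.integral_sub j1 j2, ← i1, ← i2]
  linarith [key]


end R3

end Literature.Analysis.FluidPDE

end
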